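import Literature.Topology.FourManifolds.SphereProductTube
import Literature.Topology.FourManifolds.ClosedModelRelOrientation
import Literature.AlgebraicTopology.SingularHomology.ExcisionMayerVietorisProofs
import Literature.AlgebraicTopology.SingularHomology.SphereHomology
import HarnessLib

/-!
# The tube of the diagonal in `Sᵏ × Sᵏ`: homotopy type, homology, complementary tube, interior

Topic `Literature/Topology/FourManifolds`; seventh pure-proof companion of the named fact
`Literature.Topology.FourManifolds.HomotopySphere.exists_intersectionForm_equivalent_e8Form`
(`HomotopySpheresBPOrderSignatureLeaves.lean`; A. Kosinski, *Differential Manifolds* (1993),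
VI.12: the plumbing `M(4n)` along the `E₈` tree has intersection matrix `Γ₈`), sequel of
`SphereProductTube.lean`, which constructs the plumbing pieces as the tubes
`N_c = {(p, q) ∈ Sᵏ × Sᵏ | ⟪p, q⟫ ≥ c}` (`-1 < c < 1`) of the diagonal `Δ`, compact manifolds with
boundary `{⟪p, q⟫ = c}` — the disc bundle of the tangent bundle of `Sᵏ` (Milnor–Stasheff,
*Characteristic classes* (1974), §11, Lemma 11.5 and Thm. 11.1). This file supplies the
topology of `N_c` needed to read the diagonal entry `[Σ : Σ] = 2` of `Γ₈` (Kosinski VI.(12.4))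
on the closed manifold `Sᵏ × Sᵏ` through the collapse onto the closed model `N̂_c`
(`ClosedModelAmbientCollapse.lean`). Everything is **proved**; no definition, no named fact
(D-0026); maps are given inline and homeomorphisms / homotopy equivalences existentially.

* `Literature.Topology.FourManifolds.SphereProd.norm_sq_interp`, `norm_interp_pos`,
  `inner_interp_ge` — the chord `v = (1 - t) p + t q` of unit vectors with `⟪p, q⟫ > -1`,
  `t ∈ [0, 1]`: `‖v‖² = (1-t)² + t² + 2t(1-t)⟪p, q⟫ > 0` and **`⟪p, v⟫ ≥ ⟪p, q⟫ ‖v‖`** (the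
  normalised chord is no farther from `p` than `q` is), by the factorisation
  `⟪p, q⟫² ‖v‖² - ⟪p, v⟫² = (⟪p, q⟫² - 1)(1 - t)((1 - t) + 2t⟪p, q⟫)`;
* `Literature.Topology.FourManifolds.SphereProd.Tube.exists_homotopyEquiv_sphere` — **`N_c ≃ₕ Sᵏ`**
  by `(p, q) ↦ p` and the diagonal `p ↦ (p, p)`, the homotopy sliding `q` to `p` along the great
  circle inside the tube (Milnor–Stasheff Thm. 11.1: contraction of the fibres of the tubular
  neighbourhood); hence `Tube.isZero_singularHomology` (`Hⱼ(N_c; ℤ) = 0` for `j ∉ {0, k}`,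
  Hatcher Cor. 2.11 / 2.14), `Tube.isIso_map_fst`, `Tube.isIso_map_diag`;
* `Literature.Topology.FourManifolds.SphereProd.exists_homeomorph_sublevel_tube`,
  `isZero_singularHomology_sublevel` — the complementary piece `N'_c = {⟪p, q⟫ ≤ c}`
  (`RegularSublevel`) is the tube `N_{-c}` of the anti-diagonal under `(p, q) ↦ (p, -q)`, so
  `Hⱼ(N'_c; ℤ) = 0` for `j ∉ {0, k}` — the input `Hₖ₋₁(N'_c) = 0` for the surjectivity of the
  collapse `Sᵏ × Sᵏ → N̂_c` on `Hₖ`;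
* `Literature.Topology.FourManifolds.SphereProd.exists_homeomorph_interior_tube`,
  `isOpenEmbedding_interior_tube` — the manifold interior of `N_c` is the open set
  `{⟪p, q⟫ > c}` of `Sᵏ × Sᵏ` (interior of a regular sublevel set, Milnor 1963, Thm. 3.1), openly
  embedded by the inclusion (the datum of `NullCobordism.exists_ambientCollapse`).

## References

* A. Kosinski, *Differential Manifolds* (1993), VI.12 ((12.4), the matrix `Γ₈`, p. 122).
  [Kosinski1993]
* J. Milnor, J. Stasheff, *Characteristic classes* (1974), §11, Lemma 11.5, Thm. 11.1.
  [MilnorStasheff1974]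
* J. Milnor, *Morse theory* (1963), §3, Thm. 3.1. [Milnor1963]
* A. Hatcher, *Algebraic Topology* (2002), Cor. 2.11, Cor. 2.14. [HatcherAT2002]
-/

open scoped Manifold ContDiff Topology InnerProductSpace
open Set Function CategoryTheory CategoryTheory.Limits Topology

noncomputable section

namespace Literature.Topology.FourManifolds

open Literature.AlgebraicTopology.SingularHomology Literature.Geometry.Manifold

namespace SphereProd

/-! ### The geodesic interpolation stays in the tube -/

section Analysis

variable {E : Type*} [NormedAddCommGroup E] [InnerProductSpace ℝ E]

/-- For unit vectors `p`, `q` and `t ∈ ℝ`, `‖(1 - t) p + t q‖² = (1-t)² + t² + 2t(1-t)⟪p, q⟫`.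
[folklore] -/
theorem norm_sq_interp (p q : E) (hp : ‖p‖ = 1) (hq : ‖q‖ = 1) (t : ℝ) :
    ‖(1 - t) • p + t • q‖ ^ 2 = (1 - t) ^ 2 + t ^ 2 + 2 * t * (1 - t) * ⟪p, q⟫_ℝ := by
  rw [@norm_add_sq_real, norm_smul, norm_smul, hp, hq, mul_one, mul_one, real_inner_smul_left,
    real_inner_smul_right, Real.norm_eq_abs, Real.norm_eq_abs, sq_abs, sq_abs]
  ring

/-- The interpolation of unit vectors at inner product `> -1` never vanishes on `[0, 1]`.
[folklore] -/
theorem norm_interp_pos (p q : E) (hp : ‖p‖ = 1) (hq : ‖q‖ = 1) (hs : -1 < ⟪p, q⟫_ℝ) {t : ℝ}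
    (ht0 : 0 ≤ t) (ht1 : t ≤ 1) : 0 < ‖(1 - t) • p + t • q‖ := by
  have h2 := norm_sq_interp p q hp hq t
  have hpos : 0 < (1 - t) ^ 2 + t ^ 2 + 2 * t * (1 - t) * ⟪p, q⟫_ℝ := by
    nlinarith [mul_nonneg ht0 (sub_nonneg.2 ht1), sq_nonneg (1 - 2 * t),
      mul_nonneg (mul_nonneg ht0 (sub_nonneg.2 ht1)) (le_of_lt (neg_lt_iff_pos_add.1 hs))]
  rw [← h2] at hpos
  have hne : ‖(1 - t) • p + t • q‖ ≠ 0 := fun h => by rw [h] at hpos; simp at hpos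
  exact lt_of_le_of_ne (norm_nonneg _) (Ne.symm hne)

/-- **The geodesic interpolation does not leave the tube**: for unit vectors `p`, `q` and
`t ∈ [0, 1]`, `⟪p, (1 - t) p + t q⟫ ≥ ⟪p, q⟫ · ‖(1 - t) p + t q‖` — the angle between `p` and
the normalised interpolation is at most the angle between `p` and `q`. [folklore] -/
theorem inner_interp_ge (p q : E) (hp : ‖p‖ = 1) (hq : ‖q‖ = 1) {t : ℝ} (ht0 : 0 ≤ t)
    (ht1 : t ≤ 1) : ⟪p, q⟫_ℝ * ‖(1 - t) • p + t • q‖ ≤ ⟪p, (1 - t) • p + t • q⟫_ℝ := by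
  set s := ⟪p, q⟫_ℝ with hs
  set v := (1 - t) • p + t • q with hv
  have hL : ⟪p, v⟫_ℝ = (1 - t) + t * s := by
    rw [hv, inner_add_right, real_inner_smul_right, real_inner_smul_right,
      real_inner_self_eq_norm_sq, hp, one_pow, mul_one]
  have hD : ‖v‖ ^ 2 = (1 - t) ^ 2 + t ^ 2 + 2 * t * (1 - t) * s := norm_sq_interp p q hp hq t
  have hs1 : s ≤ 1 := by
    have := real_inner_le_norm p q; rw [hp, hq, mul_one] at this; exact this
  have hs1' : -1 ≤ s := by
    have := neg_le_of_abs_le (abs_real_inner_le_norm p q); rw [hp, hq, mul_one] at this; exact this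
  have hv1 : ‖v‖ ≤ 1 := by
    have h1 : ‖v‖ ^ 2 ≤ 1 := by
      rw [hD]; nlinarith [mul_nonneg ht0 (sub_nonneg.2 ht1)]
    nlinarith [norm_nonneg v]
  rw [hL]
  by_cases hL0 : 0 ≤ (1 - t) + t * s
  · by_cases hs0 : 0 ≤ s
    · -- `s ‖v‖ ≤ s ≤ (1 - t) + t s`
      nlinarith [mul_nonneg hs0 (sub_nonneg.2 hv1)]
    · -- `s ‖v‖ ≤ 0 ≤ (1 - t) + t s`
      nlinarith [mul_nonneg (neg_nonneg.2 (le_of_lt (not_le.1 hs0))) (norm_nonneg v)]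
  · -- both sides negative: `s² ‖v‖² - L² = (s² - 1)(1 - t)((1 - t) + 2ts) ≥ 0`
    have hLneg : (1 - t) + t * s < 0 := not_le.1 hL0
    have hsneg : s < 0 := by
      by_contra h; exact hL0 (by nlinarith [not_lt.1 h, sub_nonneg.2 ht1])
    have hfac : s ^ 2 * ((1 - t) ^ 2 + t ^ 2 + 2 * t * (1 - t) * s) - ((1 - t) + t * s) ^ 2 =
        (s ^ 2 - 1) * (1 - t) * ((1 - t) + 2 * t * s) := by ring
    have h3 : (1 - t) + 2 * t * s ≤ 0 := by nlinarith [mul_nonneg ht0 (neg_nonneg.2 hsneg.le)]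
    have h12 : 0 ≤ (1 - s ^ 2) * (1 - t) := mul_nonneg (by nlinarith) (sub_nonneg.2 ht1)
    have hsq : ((1 - t) + t * s) ^ 2 ≤ (-(s * ‖v‖)) ^ 2 := by
      have : (-(s * ‖v‖)) ^ 2 = s ^ 2 * ((1 - t) ^ 2 + t ^ 2 + 2 * t * (1 - t) * s) := by
        rw [neg_sq, mul_pow, hD]
      rw [this, ← sub_nonneg, hfac]
      have : (s ^ 2 - 1) * (1 - t) * ((1 - t) + 2 * t * s) =
          ((1 - s ^ 2) * (1 - t)) * (-((1 - t) + 2 * t * s)) := by ring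
      rw [this]
      exact mul_nonneg h12 (neg_nonneg.2 h3)
    have hb : 0 ≤ -(s * ‖v‖) := by nlinarith [norm_nonneg v]
    have h := (abs_le_of_sq_le_sq' hsq hb).1
    linarith

end Analysis

/-! ### The tube is homotopy equivalent to the diagonal sphere -/

section HomotopyType

variable {k n : ℕ} {hkn : k + k = n + 1} {c : ℝ} (hc : |c| < 1)

/-- **The tube `N_c` deformation retracts onto the diagonal: `N_c ≃ₕ Sᵏ`** by `(p, q) ↦ p` and
`p ↦ (p, p)`, the homotopy `(p, q) ∼ (p, p)` sliding `q` to `p` along the great circle (the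
normalised chord `(1 - t) p + t q`), which stays in the tube (`inner_interp_ge`). This is the
contraction of the fibres of the disc bundle of the tangent bundle of `Sᵏ` (Milnor–Stasheff 1974,
§11, Thm. 11.1). [cite: MilnorStasheff1974, §11 Thm. 11.1 and Lemma 11.5] -/
theorem Tube.exists_homotopyEquiv_sphere :
    ∃ e : ContinuousMap.HomotopyEquiv (Tube k n hkn hc)
        (Metric.sphere (0 : EuclideanSpace ℝ (Fin (k + 1))) 1),
      (∀ y, e y = (Tube.toProd hc y).1) ∧ ∀ p, e.invFun p = Tube.diag hc p := by
  have hc1 : -1 < c := (abs_lt.1 hc).1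
  -- the two maps
  set f : C(Tube k n hkn hc, Metric.sphere (0 : EuclideanSpace ℝ (Fin (k + 1))) 1) :=
    ⟨fun y => (Tube.toProd hc y).1,
      continuous_fst.comp ((Rechart.continuous_out _ _).comp (RegularSublevel.continuous_incl _))⟩
    with hf
  set g : C(Metric.sphere (0 : EuclideanSpace ℝ (Fin (k + 1))) 1, Tube k n hkn hc) :=
    ⟨Tube.diag hc, Continuous.subtype_mk ((Rechart.continuous_into _ _).comp
      (continuous_id.prodMk continuous_id)) _⟩ with hg
  -- the chord from `p` to `q`, normalised
  have hv0 : ∀ (t : unitInterval) (y : Tube k n hkn hc),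
      0 < ‖(1 - (t : ℝ)) • ((Tube.toProd hc y).1 : EuclideanSpace ℝ (Fin (k + 1))) +
        (t : ℝ) • ((Tube.toProd hc y).2 : EuclideanSpace ℝ (Fin (k + 1)))‖ := fun t y =>
    norm_interp_pos _ _ (norm_eq_of_mem_sphere _) (norm_eq_of_mem_sphere _)
      (hc1.trans_le (Tube.le_inner_toProd hc y)) t.2.1 t.2.2
  set V : unitInterval × Tube k n hkn hc → EuclideanSpace ℝ (Fin (k + 1)) := fun ty =>
    (1 - (ty.1 : ℝ)) • ((Tube.toProd hc ty.2).1 : EuclideanSpace ℝ (Fin (k + 1))) +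
      (ty.1 : ℝ) • ((Tube.toProd hc ty.2).2 : EuclideanSpace ℝ (Fin (k + 1))) with hV
  have hVc : Continuous V := by
    have hp : Continuous fun ty : unitInterval × Tube k n hkn hc =>
        ((Tube.toProd hc ty.2).1 : EuclideanSpace ℝ (Fin (k + 1))) :=
      continuous_subtype_val.comp (continuous_fst.comp ((Rechart.continuous_out _ _).comp
        ((RegularSublevel.continuous_incl _).comp continuous_snd)))
    have hq : Continuous fun ty : unitInterval × Tube k n hkn hc =>
        ((Tube.toProd hc ty.2).2 : EuclideanSpace ℝ (Fin (k + 1))) :=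
      continuous_subtype_val.comp (continuous_snd.comp ((Rechart.continuous_out _ _).comp
        ((RegularSublevel.continuous_incl _).comp continuous_snd)))
    have ht : Continuous fun ty : unitInterval × Tube k n hkn hc => ((ty.1 : ℝ)) :=
      continuous_subtype_val.comp continuous_fst
    exact ((continuous_const.sub ht).smul hp).add (ht.smul hq)
  set γ : unitInterval × Tube k n hkn hc → Metric.sphere (0 : EuclideanSpace ℝ (Fin (k + 1))) 1 :=
    fun ty => ⟨(‖V ty‖)⁻¹ • V ty, by
      rw [mem_sphere_zero_iff_norm, norm_smul, norm_inv, norm_norm,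
        inv_mul_cancel₀ (hv0 ty.1 ty.2).ne']⟩ with hγ
  have hγc : Continuous γ :=
    Continuous.subtype_mk (((continuous_norm.comp hVc).inv₀ fun ty => (hv0 ty.1 ty.2).ne').smul
      hVc) _
  -- it stays in the tube
  have hmem : ∀ ty : unitInterval × Tube k n hkn hc,
      c ≤ ⟪((Tube.toProd hc ty.2).1 : EuclideanSpace ℝ (Fin (k + 1))),
        ((γ ty : Metric.sphere (0 : EuclideanSpace ℝ (Fin (k + 1))) 1) : EuclideanSpace ℝ _)⟫_ℝ := by
    intro ty
    have hle := Tube.le_inner_toProd hc ty.2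
    have hin := inner_interp_ge ((Tube.toProd hc ty.2).1 : EuclideanSpace ℝ (Fin (k + 1)))
      ((Tube.toProd hc ty.2).2 : EuclideanSpace ℝ (Fin (k + 1))) (norm_eq_of_mem_sphere _)
      (norm_eq_of_mem_sphere _) ty.1.2.1 ty.1.2.2
    have hpos := hv0 ty.1 ty.2
    change c ≤ ⟪_, (‖V ty‖)⁻¹ • V ty⟫_ℝ
    rw [real_inner_smul_right]
    rw [le_inv_mul_iff₀' ?_] <;> [skip; exact hpos]
    calc c * ‖V ty‖ ≤ ⟪((Tube.toProd hc ty.2).1 : EuclideanSpace ℝ (Fin (k + 1))),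
          ((Tube.toProd hc ty.2).2 : EuclideanSpace ℝ (Fin (k + 1)))⟫_ℝ * ‖V ty‖ :=
          mul_le_mul_of_nonneg_right hle (norm_nonneg _)
      _ ≤ _ := hin
  -- the homotopy `(p, q) ∼ (p, p)`
  set H : C(unitInterval × Tube k n hkn hc, Tube k n hkn hc) :=
    ⟨fun ty => Tube.ofProd hc ((Tube.toProd hc ty.2).1, γ ty) (hmem ty),
      Continuous.subtype_mk ((Rechart.continuous_into _ _).comp
        ((continuous_fst.comp ((Rechart.continuous_out _ _).comp
          ((RegularSublevel.continuous_incl _).comp continuous_snd))).prodMk hγc)) _⟩ with hH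
  have hH0 : ∀ y, H (0, y) = g (f y) := by
    intro y
    apply Tube.toProd_injective hc
    change ((Tube.toProd hc y).1, γ (0, y)) = Tube.toProd hc (Tube.diag hc (Tube.toProd hc y).1)
    rw [Tube.diag, Tube.toProd_ofProd]
    congr 1
    apply Subtype.ext
    change (‖V (0, y)‖)⁻¹ • V (0, y) = _
    have : V (0, y) = ((Tube.toProd hc y).1 : EuclideanSpace ℝ (Fin (k + 1))) := by
      simp [hV]
    rw [this, norm_eq_of_mem_sphere, inv_one, one_smul]
  have hH1 : ∀ y, H (1, y) = y := by
    intro y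
    apply Tube.toProd_injective hc
    change ((Tube.toProd hc y).1, γ (1, y)) = Tube.toProd hc y
    refine Prod.ext rfl ?_
    apply Subtype.ext
    change (‖V (1, y)‖)⁻¹ • V (1, y) = _
    have : V (1, y) = ((Tube.toProd hc y).2 : EuclideanSpace ℝ (Fin (k + 1))) := by
      simp [hV]
    rw [this, norm_eq_of_mem_sphere, inv_one, one_smul]
  have hleft : (g.comp f).Homotopic (ContinuousMap.id _) :=
    ⟨{ toContinuousMap := H, map_zero_left := hH0, map_one_left := hH1 }⟩
  exact ⟨{ toFun := f, invFun := g, left_inv := hleft, right_inv := ContinuousMap.Homotopic.refl _ },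
    fun y => rfl, fun p => rfl⟩

end HomotopyType

/-! ### Homology of the tube; the complementary tube; the interior -/

section Homology

variable {k n : ℕ} {hkn : k + k = n + 1} {c : ℝ} (hc : |c| < 1)

/-- **`Hⱼ(N_c; ℤ) = 0` for `j ∉ {0, k}`**: the tube is homotopy equivalent to `Sᵏ`
(`Tube.exists_homotopyEquiv_sphere`) and `Hⱼ(Sᵏ) = 0` (Hatcher 2002, Cor. 2.14, Cor. 2.11).
[cite: HatcherAT2002, Cor. 2.11, Cor. 2.14] -/
theorem Tube.isZero_singularHomology {j : ℕ} (hj0 : j ≠ 0) (hjk : j ≠ k) :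
    IsZero (singularHomology ℤ ℤ (Tube k n hkn hc) j) := by
  obtain ⟨e, -, -⟩ := Tube.exists_homotopyEquiv_sphere (hkn := hkn) hc
  haveI := isIso_map_of_homotopyEquiv ℤ ℤ e j
  exact (isZero_singularHomology_sphere_holds ℤ ℤ hj0 hjk).of_iso
    (asIso (singularHomology.map ℤ ℤ (e.toFun) j))

/-- **The projection to the diagonal sphere is a homology isomorphism**: `(p, q) ↦ p` induces
isomorphisms `Hⱼ(N_c; ℤ) ≅ Hⱼ(Sᵏ; ℤ)` (it is a homotopy equivalence with inverse the diagonal).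
[cite: HatcherAT2002, Cor. 2.11] -/
theorem Tube.isIso_map_fst (j : ℕ) :
    IsIso (singularHomology.map ℤ ℤ (⟨fun y => (Tube.toProd hc y).1,
      continuous_fst.comp ((Rechart.continuous_out _ _).comp (RegularSublevel.continuous_incl _))⟩ :
        C(Tube k n hkn hc, Metric.sphere (0 : EuclideanSpace ℝ (Fin (k + 1))) 1)) j) := by
  obtain ⟨e, he, -⟩ := Tube.exists_homotopyEquiv_sphere (hkn := hkn) hc
  have h := isIso_map_of_homotopyEquiv ℤ ℤ e j
  have : (e.toFun : C(Tube k n hkn hc, _)) = ⟨fun y => (Tube.toProd hc y).1,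
      continuous_fst.comp ((Rechart.continuous_out _ _).comp (RegularSublevel.continuous_incl _))⟩ := by
    ext y : 1; exact he y
  rwa [this] at h

/-- **The diagonal is a homology isomorphism** `Hⱼ(Sᵏ; ℤ) ≅ Hⱼ(N_c; ℤ)` (homotopy inverse of the
projection). [cite: HatcherAT2002, Cor. 2.11] -/
theorem Tube.isIso_map_diag (j : ℕ) :
    IsIso (singularHomology.map ℤ ℤ (⟨Tube.diag hc, Continuous.subtype_mk
      ((Rechart.continuous_into _ _).comp (continuous_id.prodMk continuous_id)) _⟩ :
        C(Metric.sphere (0 : EuclideanSpace ℝ (Fin (k + 1))) 1, Tube k n hkn hc)) j) := by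
  obtain ⟨e, -, he⟩ := Tube.exists_homotopyEquiv_sphere (hkn := hkn) hc
  have h := isIso_map_of_homotopyEquiv ℤ ℤ e.symm j
  have : (e.symm.toFun : C(_, Tube k n hkn hc)) = ⟨Tube.diag hc, Continuous.subtype_mk
      ((Rechart.continuous_into _ _).comp (continuous_id.prodMk continuous_id)) _⟩ := by
    ext p : 1; exact he p
  rwa [this] at h

/-- **The complementary tube `N'_c = {⟪p, q⟫ ≤ c}` is the tube `N_{-c}` of the anti-diagonal**:
`(p, q) ↦ (p, -q)` is a homeomorphism `{⟪p, q⟫ ≤ c} ≅ {⟪p, q⟫ ≥ -c}`. [folklore] -/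
theorem exists_homeomorph_sublevel_tube :
    ∃ φ : RegularSublevel (isRegularLevel_dotFn (hkn := hkn) hc) ≃ₜ
        Tube k n hkn (c := -c) (by rwa [abs_neg]),
      ∀ y, Tube.toProd _ (φ y) =
        ((pt (RegularSublevel.incl _ y)).1, -(pt (RegularSublevel.incl _ y)).2) := by
  have hneg : ∀ (p q : Metric.sphere (0 : EuclideanSpace ℝ (Fin (k + 1))) 1),
      ⟪(p : EuclideanSpace ℝ (Fin (k + 1))), ((-q : Metric.sphere (0 : EuclideanSpace ℝ _) 1) :
        EuclideanSpace ℝ (Fin (k + 1)))⟫_ℝ =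
        -⟪(p : EuclideanSpace ℝ (Fin (k + 1))), (q : EuclideanSpace ℝ _)⟫_ℝ :=
    fun p q => by rw [coe_neg_sphere, inner_neg_right]
  -- forward and backward maps
  have hfwd : ∀ y : RegularSublevel (isRegularLevel_dotFn (hkn := hkn) hc),
      -c ≤ ⟪((pt (RegularSublevel.incl _ y)).1 : EuclideanSpace ℝ (Fin (k + 1))),
        ((-(pt (RegularSublevel.incl _ y)).2 : Metric.sphere (0 : EuclideanSpace ℝ _) 1) :
          EuclideanSpace ℝ (Fin (k + 1)))⟫_ℝ := by
    intro y
    rw [hneg, neg_le_neg_iff]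
    exact y.2
  have hbwd : ∀ z : Tube k n hkn (c := -c) (by rwa [abs_neg]),
      dotFn (Rechart.into (tubeModelHomeo k n hkn) _
        ((Tube.toProd _ z).1, -(Tube.toProd _ z).2)) ≤ c := by
    intro z
    have h := Tube.le_inner_toProd (hkn := hkn) (c := -c) (by rwa [abs_neg]) z
    change ⟪((Tube.toProd _ z).1 : EuclideanSpace ℝ (Fin (k + 1))),
      ((-(Tube.toProd _ z).2 : Metric.sphere (0 : EuclideanSpace ℝ _) 1) : EuclideanSpace ℝ _)⟫_ℝ ≤ c
    rw [hneg]
    linarith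
  refine ⟨{ toFun := fun y => Tube.ofProd _ ((pt (RegularSublevel.incl _ y)).1,
              -(pt (RegularSublevel.incl _ y)).2) (hfwd y)
            invFun := fun z => RegularSublevel.mk _ (Rechart.into (tubeModelHomeo k n hkn) _
              ((Tube.toProd _ z).1, -(Tube.toProd _ z).2)) (hbwd z)
            left_inv := fun y => ?_
            right_inv := fun z => ?_
            continuous_toFun := ?_
            continuous_invFun := ?_ }, fun y => rfl⟩
  · apply Subtype.ext
    change Rechart.into (tubeModelHomeo k n hkn) _ (_, - -(pt (RegularSublevel.incl _ y)).2) = _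
    rw [neg_neg]
    exact Rechart.into_out _ _ _
  · apply Tube.toProd_injective
    rw [Tube.toProd_ofProd]
    change ((Tube.toProd _ z).1, - -(Tube.toProd _ z).2) = _
    rw [neg_neg]
  · exact Continuous.subtype_mk ((Rechart.continuous_into _ _).comp
      ((continuous_fst.comp ((Rechart.continuous_out _ _).comp continuous_subtype_val)).prodMk
        ((continuous_snd.comp ((Rechart.continuous_out _ _).comp continuous_subtype_val)).neg))) _
  · exact Continuous.subtype_mk ((Rechart.continuous_into _ _).comp
      ((continuous_fst.comp ((Rechart.continuous_out _ _).comp continuous_subtype_val)).prodMk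
        ((continuous_snd.comp ((Rechart.continuous_out _ _).comp continuous_subtype_val)).neg))) _

/-- **`Hⱼ(N'_c; ℤ) = 0` for `j ∉ {0, k}`** for the complementary tube `{⟪p, q⟫ ≤ c}` (it is a tube
of the anti-diagonal). [cite: HatcherAT2002, Cor. 2.11, Cor. 2.14] -/
theorem isZero_singularHomology_sublevel {j : ℕ} (hj0 : j ≠ 0) (hjk : j ≠ k) :
    IsZero (singularHomology ℤ ℤ (RegularSublevel (isRegularLevel_dotFn (hkn := hkn) hc)) j) := by
  obtain ⟨φ, -⟩ := exists_homeomorph_sublevel_tube (hkn := hkn) hc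
  exact (Tube.isZero_singularHomology (hkn := hkn) (c := -c) (by rwa [abs_neg]) hj0 hjk).of_iso
    (singularHomology.mapIso ℤ ℤ φ j)

/-- **The interior of the tube is the open set `{⟪p, q⟫ > c}` of `Sᵏ × Sᵏ`**: a homeomorphism
between `{x | c < f x}` and the manifold interior of `N_c` (the interior of a regular sublevel set
is the strict sublevel set, Milnor 1963, Thm. 3.1). [cite: Milnor1963, Thm. 3.1] -/
theorem exists_homeomorph_interior_tube :
    ∃ φ : ↥({x : PM k n hkn | c < dotFn x}) ≃ₜ ManifoldInterior n (Tube k n hkn hc),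
      ∀ x, (RegularSublevel.incl _ (φ x).1 : PM k n hkn) = x.1 := by
  have hint : ∀ y : Tube k n hkn hc, y ∈ (𝓡∂ (n + 1)).interior (Tube k n hkn hc) ↔
      c < dotFn (RegularSublevel.incl _ y) := by
    intro y
    change (𝓡∂ (n + 1)).IsInteriorPoint y ↔ _
    rw [RegularSublevel.isInteriorPoint_iff, sub_neg]
  refine ⟨{ toFun := fun x => ⟨RegularSublevel.mk _ x.1 (sub_nonpos.2 x.2.le), (hint _).2 x.2⟩
            invFun := fun y => ⟨RegularSublevel.incl _ y.1, (hint _).1 y.2⟩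
            left_inv := fun x => rfl
            right_inv := fun y => rfl
            continuous_toFun := Continuous.subtype_mk (Continuous.subtype_mk continuous_subtype_val _) _
            continuous_invFun := Continuous.subtype_mk
              ((RegularSublevel.continuous_incl _).comp continuous_subtype_val) _ }, fun x => rfl⟩

/-- **The interior of the tube embeds openly in `Sᵏ × Sᵏ`** with image `{⟪p, q⟫ > c}`.
[cite: Milnor1963, Thm. 3.1] -/
theorem isOpenEmbedding_interior_tube :
    IsOpenEmbedding (fun y : ManifoldInterior n (Tube k n hkn hc) =>
      (RegularSublevel.incl _ y.1 : PM k n hkn)) ∧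
    range (fun y : ManifoldInterior n (Tube k n hkn hc) => (RegularSublevel.incl _ y.1 : PM k n hkn)) =
      {x : PM k n hkn | c < dotFn x} := by
  obtain ⟨φ, hφ⟩ := exists_homeomorph_interior_tube (hkn := hkn) hc
  have hfac : (fun y : ManifoldInterior n (Tube k n hkn hc) => (RegularSublevel.incl _ y.1 : PM k n hkn)) =
      Subtype.val ∘ φ.symm := by
    ext y
    have := hφ (φ.symm y)
    rw [φ.apply_symm_apply] at this
    exact this
  have hopen : IsOpen {x : PM k n hkn | c < dotFn x} :=
    isOpen_lt continuous_const contMDiff_dotFn.continuous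
  rw [hfac]
  refine ⟨(hopen.isOpenEmbedding_subtypeVal).comp φ.symm.isOpenEmbedding, ?_⟩
  rw [range_comp, φ.symm.surjective.range_eq, image_univ, Subtype.range_coe]

end Homology

end SphereProd

end Literature.Topology.FourManifolds

end
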